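import Summits.HubbardSuperconductivity.HubbardLadder.Bounds.EulerActivityBound
import Summits.HubbardSuperconductivity.HubbardLadder.Bounds.TwistInsensitivityWeighted
import HarnessLib

/-!
# Twist insensitivity of the `t–t'` Hubbard torus for `T ≥ 160(|t|+|t'|)`:
# bounds.tex Theorem 12 (i)–(ii) with the Hölder-constant activity bound — node (i) of #181.1 PROVED

HONEST FRAMING (cell pub-hubbard): ladder R1–R4 with certified numbers; no claim on H/H₀. This file
is a BOUND FOR A MODEL CLASS (the seam-twisted `t–t'` Hubbard torus at high temperature, any sign
of `U`, any `μ`); no materials claim. IN THE TREE (LEAN FILING REQUEST #198.4, p279269).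

WHAT IS PROVED. With the elementary Hölder-constant bound of `EulerActivityBound`
(`|couplingWeight c K| ≤ ∏_{b∈K}(e^{|c_b|} - 1)`, real on-site parameters) in place of the Cauchy
bound `∏ |c_b| e^{1+|c_b|}` of #195.3, the one-site Kotecký–Preiss smallness of the twisted
activities holds under `16 s e^{2s} (e^{a+δ}+a)² ≤ a`, `s = |β|(1+|t'|)`
(`sum_norm_ttActivity_mul_exp_le_exp`; per-bond weight `e^{|c_b|} - 1 ≤ |c_b| e^{2s}`, weighted
degree `≤ 16 s e^{2s}` from #195.4's `sum_norm_ttFluxCoupling_le`). Feeding this into #196's chain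
(`re_polymerLogZ_sub_eq_log_sub_of_isSmallActivityA`, the tree's
`IsSmallActivityA.norm_polymerLogZ_sub_le_of_eq_of_card_lt`) gives
`|log Re Z(0) - log Re Z(θ)| ≤ 2a L² e^{-δL}` (`abs_log_partitionFn_twist_sub_le_exp`), and with
`δ := b + 8y`, `y = β(1+|t'|)`, the hypothesis `KP̄(y,a,b) = 16 y e^{4y}(e^{a+b+8y}+a)² ≤ a` of
#181.1 implies it: **`highTemperatureTwistInsensitivityTT'_holds : HighTemperatureTwistInsensitivityTT'`**
(node (i) of #181.1), hence `HighTemperatureNoThermalStiffnessTT'` and the certified reading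
`HighTemperatureNoThermalStiffnessTT'At160` (`T ≥ 160(|t|+|t'|)`, via #181.1's reductions and its
kernel-certified `kpBarLHS_inst160`); the reading of (i) in the same window is the NEW node
`HighTemperatureTwistInsensitivityTT'At160` (`|Δ log Z| ≤ 0.754 L² e^{-L/1000}`), PROVED.

References: KoteckyPreiss1986 (Thm p. 492); Ueltschi1999 §2.3, §3; bounds.tex §12 Thm 12,
Lemma 12.2, Remark 12(d).
-/

namespace Summit.HubbardSuperconductivity.HubbardLadder.Bounds

open Matrix Finset Literature.MathematicalPhysics.QuantumLattice Literature.Probability.LatticeModels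
open scoped ComplexConjugate ComplexOrder

/-! ### One-site KP smallness with the Hölder constant (generic lattice, real on-site parameters) -/

section Smallness

variable {Λ : Type*} [LinearOrder Λ] [Fintype Λ] {D : Finset (Bond Λ)}


/-- **THEOREM (one-site KP smallness of coupling-function activities, Catalan × Hölder form).** For
real `β, U, μ`, `|c_b| ≤ δ_b` on `D`, weighted degree `Σ_{b ∈ D, v ∈ b} (e^{δ_b} - 1) ≤ W` at every
site, `a ≥ 0` and `e^{a} + W F² ≤ F`: for every site `x` and finite family `𝒜` of site sets through
`x`, `Σ_{A ∈ 𝒜} |couplingActivity D c A| e^{a|A|} ≤ F - e^{a}`. Sibling of #195.3's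
`sum_norm_couplingActivity_mul_exp_le_catalan` with the Hölder constant.
[folklore: KoteckyPreiss1986 condition (1) via the tree-graph bound; Ueltschi1999 §3] -/
theorem sum_norm_couplingActivity_mul_exp_le_catalan_exp (β U μ : ℝ) {δ : Bond Λ → ℝ}
    {c : Bond Λ → ℂ} (hc : ∀ b ∈ D, ‖c b‖ ≤ δ b) {a W F : ℝ} (ha : 0 ≤ a)
    (hW : ∀ v : Λ, ∑ b ∈ D.filter (fun b => v ∈ Bond.verts b), (Real.exp (δ b) - 1) ≤ W)
    (hF : Real.exp a + W * F ^ 2 ≤ F) (x : Λ) (𝒜 : Finset (Finset Λ)) (h𝒜 : ∀ A ∈ 𝒜, x ∈ A) :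
    ∑ A ∈ 𝒜, ‖couplingActivity D (β : ℂ) (U : ℂ) (μ : ℂ) c A‖ * Real.exp (a * A.card) ≤
      F - Real.exp a := by
  classical
  set CC := connectedCellSets Bond.verts D with hCC
  set f : Finset (Bond Λ) → ℝ := fun X =>
    ‖couplingWeight (β : ℂ) (U : ℂ) (μ : ℂ) c X‖ * Real.exp (a * ((cellSupp Bond.verts X).card : ℝ))
    with hf
  have hf0 : ∀ X, 0 ≤ f X := fun X => by positivity
  set Sx := CC.filter fun X => x ∈ cellSupp Bond.verts X with hSx
  -- Step a: bound by a sum over connected bond sets through `x` (verbatim from #195.3)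
  have stepA : ∑ A ∈ 𝒜, ‖couplingActivity D (β : ℂ) (U : ℂ) (μ : ℂ) c A‖ * Real.exp (a * A.card) ≤
      ∑ X ∈ Sx, f X := by
    have h1 : ∀ A ∈ 𝒜, ‖couplingActivity D (β : ℂ) (U : ℂ) (μ : ℂ) c A‖ * Real.exp (a * A.card) ≤
        ∑ X ∈ CC.filter (fun X => cellSupp Bond.verts X = A), f X := by
      intro A _
      rw [couplingActivity_apply, ← hCC]
      refine (mul_le_mul_of_nonneg_right (norm_sum_le _ _) (Real.exp_nonneg _)).trans ?_
      rw [Finset.sum_mul]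
      refine Finset.sum_le_sum fun X hX => le_of_eq ?_
      simp only [hf]
      rw [(Finset.mem_filter.1 hX).2]
    refine (Finset.sum_le_sum h1).trans ?_
    rw [← Finset.sum_biUnion]
    · refine Finset.sum_le_sum_of_subset_of_nonneg ?_ fun X _ _ => hf0 X
      intro X hX
      obtain ⟨A, hA, hXA⟩ := Finset.mem_biUnion.1 hX
      obtain ⟨hXCC, hXsupp⟩ := Finset.mem_filter.1 hXA
      exact Finset.mem_filter.2 ⟨hXCC, hXsupp ▸ h𝒜 A hA⟩
    · intro A hA B hB hAB
      refine Finset.disjoint_left.2 fun X hXA hXB => hAB ?_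
      rw [← (Finset.mem_filter.1 hXA).2, ← (Finset.mem_filter.1 hXB).2]
  -- Step b: each term is at most the tree-graph weight, now with `w_b = e^{δ_b} - 1`
  set w : Bond Λ → ℝ := fun b => Real.exp (δ b) - 1 with hw
  have hw0 : ∀ b ∈ D, 0 ≤ w b := fun b hb => by
    have : 0 ≤ δ b := (norm_nonneg _).trans (hc b hb)
    simp only [hw, sub_nonneg]
    exact Real.one_le_exp this
  have stepB : ∀ X ∈ Sx, f X ≤ (∏ b ∈ X, w b) * Real.exp (a * ((cellSupp Bond.verts X).card : ℝ)) := by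
    intro X hX
    have hXD : X ⊆ D := (mem_connectedCellSets.1 (Finset.mem_filter.1 hX).1).1
    refine mul_le_mul_of_nonneg_right ((norm_couplingWeight_le_prod_exp_sub_one β U μ c X).trans ?_)
      (Real.exp_nonneg _)
    refine Finset.prod_le_prod (fun b _ => sub_nonneg.2 (Real.one_le_exp (norm_nonneg _))) ?_
    intro b hb
    simp only [hw, sub_le_sub_iff_right, Real.exp_le_exp]
    exact hc b (hXD hb)
  -- Step c: the Catalan entropy bound (#195.2)
  calc ∑ A ∈ 𝒜, ‖couplingActivity D (β : ℂ) (U : ℂ) (μ : ℂ) c A‖ * Real.exp (a * A.card)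
      ≤ ∑ X ∈ Sx, f X := stepA
    _ ≤ ∑ X ∈ Sx, (∏ b ∈ X, w b) * Real.exp (a * ((cellSupp Bond.verts X).card : ℝ)) :=
        Finset.sum_le_sum stepB
    _ ≤ F - Real.exp a := sum_prod_mul_exp_card_cellSupp_le hw0 ha hW hF x

end Smallness

/-! ### The twisted `t–t'` torus -/

section Torus

open Literature.MathematicalPhysics.QuantumFieldTheory

variable {L : ℕ} [NeZero L]

/-- **One-site Kotecký–Preiss smallness of the twisted activities, Hölder form**: with
`s = |β|(1+|t'|)`, if `a, δ ≥ 0` and `16 s e^{2s} (e^{a+δ}+a)² ≤ a` then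
`Σ_{A ∋ x} |ρ_θ(A)| e^{(a+δ)|A|} ≤ a` for every site `x` and every `θ, U, μ`. [this file] -/
theorem sum_norm_ttActivity_mul_exp_le_exp (hL : 3 ≤ L) (β t' U μ θ : ℝ) {a δ : ℝ} (ha : 0 ≤ a)
    (hδ : 0 ≤ δ)
    (hsmall : 16 * (|β| * (1 + |t'|)) * Real.exp (2 * (|β| * (1 + |t'|))) *
      (Real.exp (a + δ) + a) ^ 2 ≤ a)
    (x : FermionTorus 2 L) (𝒜 : Finset (Finset (FermionTorus 2 L))) (h𝒜 : ∀ A ∈ 𝒜, x ∈ A) :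
    ∑ A ∈ 𝒜, ‖ttActivity L β t' U μ θ A‖ * Real.exp ((a + δ) * A.card) ≤ a := by
  have haδ : (0 : ℝ) ≤ a + δ := add_nonneg ha hδ
  have hF : Real.exp (a + δ) + 16 * (|β| * (1 + |t'|)) * Real.exp (2 * (|β| * (1 + |t'|))) *
      (Real.exp (a + δ) + a) ^ 2 ≤ Real.exp (a + δ) + a := by linarith
  have key : ∑ A ∈ 𝒜, ‖ttActivity L β t' U μ θ A‖ * Real.exp ((a + δ) * A.card) ≤
      (Real.exp (a + δ) + a) - Real.exp (a + δ) := by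
    simp only [ttActivity, siteActivityC_eq_couplingActivity]
    refine sum_norm_couplingActivity_mul_exp_le_catalan_exp β U μ
      (δ := fun b => ‖ttFluxCoupling L β t' θ b‖) (fun _ _ => le_rfl) haδ (fun v => ?_) hF x 𝒜 h𝒜
    -- the weighted degree `Σ_{b ∋ v} (e^{|c_b|} - 1) ≤ Σ_{b ∋ v} |c_b| e^{2s} ≤ 16 s e^{2s}`
    -- (`e^x - 1 ≤ x e^x`, folklore, kept local: the tree has several namespace-local copies)
    have hem : ∀ x : ℝ, Real.exp x - 1 ≤ x * Real.exp x := fun x => by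
      have h2 : Real.exp x * (-x + 1) ≤ Real.exp x * Real.exp (-x) :=
        mul_le_mul_of_nonneg_left (Real.add_one_le_exp (-x)) (Real.exp_pos x).le
      rw [← Real.exp_add, add_neg_cancel, Real.exp_zero] at h2
      linarith
    have hb1 : ∀ b : Bond (FermionTorus 2 L), Real.exp ‖ttFluxCoupling L β t' θ b‖ - 1 ≤
        ‖ttFluxCoupling L β t' θ b‖ * Real.exp (2 * (|β| * (1 + |t'|))) := fun b =>
      (hem _).trans (mul_le_mul_of_nonneg_left (Real.exp_le_exp.2 (by
        have := norm_ttFluxCoupling_le hL β t' θ b; linarith)) (norm_nonneg _))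
    refine (Finset.sum_le_sum fun b _ => hb1 b).trans ?_
    rw [← Finset.sum_mul]
    exact mul_le_mul_of_nonneg_right (sum_norm_ttFluxCoupling_le β t' θ v _
      fun b hb => (@mem_verts_iff _ (_) _ _).1 ((@Finset.mem_filter _ _ (_) _ _).1 hb).2) (Real.exp_nonneg _)
  linarith

/-- **Smallness with weight `a`** (Hölder form): under `16 s e^{2s} (e^{a+δ}+a)² ≤ a`, `a, δ > 0`,
the twisted activities satisfy the tree's `IsSmallActivityA · a δ`, for every `θ, U, μ`. [this file] -/
theorem isSmallActivityA_ttActivity_exp (hL : 3 ≤ L) (β t' U μ θ : ℝ) {a δ : ℝ} (ha : 0 < a)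
    (hδ : 0 < δ)
    (hsmall : 16 * (|β| * (1 + |t'|)) * Real.exp (2 * (|β| * (1 + |t'|))) *
      (Real.exp (a + δ) + a) ^ 2 ≤ a) :
    IsSmallActivityA (ttActivity L β t' U μ θ) a δ where
  rho_empty := siteActivityC_empty _ _ _ _ _
  a_pos := ha
  delta_pos := hδ
  sum_le x 𝒜 h𝒜 := sum_norm_ttActivity_mul_exp_le_exp hL β t' U μ θ ha.le hδ.le hsmall x 𝒜 h𝒜

/-- **THEOREM (twist insensitivity at high temperature, Hölder constants).** For `L ≥ 3`, real
`t', U, μ, β, θ`, `a > 0`, `δ > 0` with `16 s e^{2s} (e^{a+δ}+a)² ≤ a`, `s = |β|(1+|t'|)`: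
`|log Re Z_L(0) - log Re Z_L(θ)| ≤ 2a L² e^{-δL}`. [this file] -/
theorem abs_log_partitionFn_twist_sub_le_exp (hL : 3 ≤ L) (t' U μ β θ : ℝ) {a δ : ℝ} (ha : 0 < a)
    (hδ : 0 < δ)
    (hsmall : 16 * (|β| * (1 + |t'|)) * Real.exp (2 * (|β| * (1 + |t'|))) *
      (Real.exp (a + δ) + a) ^ 2 ≤ a) :
    |Real.log (partitionFn β (hubbardTorusTT'FluxMu L t' U μ 0)).re -
        Real.log (partitionFn β (hubbardTorusTT'FluxMu L t' U μ θ)).re| ≤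
      2 * a * (L : ℝ) ^ 2 * Real.exp (-(δ * L)) := by
  have hL0 : (0 : ℝ) < L := by exact_mod_cast (show 0 < L by omega)
  have hθ := isSmallActivityA_ttActivity_exp hL β t' U μ θ ha hδ hsmall
  have h0 := isSmallActivityA_ttActivity_exp hL β t' U μ 0 ha hδ hsmall
  have h := hθ.norm_polymerLogZ_sub_le_of_eq_of_card_lt h0
    (Finset.univ : Finset (FermionTorus 2 L)).powerset hL0
    (fun A _ hA => ttActivity_eq_of_card_lt hL β t' U μ θ (by exact_mod_cast hA))
  have hcard : (Fintype.card (FermionTorus 2 L) : ℝ) = (L : ℝ) ^ 2 := by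
    simp [FermionTorus, Fintype.card_lex]
  rw [hcard] at h
  rw [abs_sub_comm, ← re_polymerLogZ_sub_eq_log_sub_of_isSmallActivityA hL β t' U μ θ hθ h0]
  exact (Complex.abs_re_le_norm _).trans h

/-! ### Node (i) of #181.1 and its corollaries -/

/-- `KP̄(y,a,b) ≤ a` (#181.1's `kpBarLHS`, `y = β(1+|t'|)`, `β > 0`) implies the Hölder-form
hypothesis with `δ = b + 8y` (`e^{2y} ≤ e^{4y}`). [this file] -/
theorem kpExp_of_kpBarLHS {β t' a b : ℝ} (hβ : 0 < β)
    (h : kpBarLHS (β * (1 + |t'|)) a b ≤ a) :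
    16 * (|β| * (1 + |t'|)) * Real.exp (2 * (|β| * (1 + |t'|))) *
      (Real.exp (a + (b + 8 * (β * (1 + |t'|)))) + a) ^ 2 ≤ a := by
  rw [abs_of_pos hβ]
  refine le_trans ?_ h
  unfold kpBarLHS
  have hy : 0 ≤ β * (1 + |t'|) := by positivity
  rw [show a + (b + 8 * (β * (1 + |t'|))) = a + b + 8 * (β * (1 + |t'|)) by ring]
  refine mul_le_mul_of_nonneg_right (mul_le_mul_of_nonneg_left (Real.exp_le_exp.2 (by linarith))
    (by positivity)) (sq_nonneg _)

/-- **PROOF of node (i) of #181.1** (`HighTemperatureTwistInsensitivityTT'`, bounds.tex Thm 12 (i)):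
for `L ≥ 3`, real `t', U, μ`, `β > 0`, `a > 0`, `b ≥ 0` with `KP̄(β(1+|t'|), a, b) ≤ a`, and every
seam twist `θ`: `|log Re Z(0) - log Re Z(θ)| ≤ 2a L² e^{-bL}`. [this file] -/
theorem highTemperatureTwistInsensitivityTT'_holds : HighTemperatureTwistInsensitivityTT' := by
  intro L _ hL t' U μ β a b hβ ha hb hkp θ
  have hy : 0 < β * (1 + |t'|) := by positivity
  have hδ : 0 < b + 8 * (β * (1 + |t'|)) := by positivity
  have h := abs_log_partitionFn_twist_sub_le_exp hL t' U μ β θ ha hδ (kpExp_of_kpBarLHS hβ hkp)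
  refine h.trans (mul_le_mul_of_nonneg_left (Real.exp_le_exp.2 ?_) (by positivity))
  have hL0 : (0 : ℝ) ≤ L := Nat.cast_nonneg L
  nlinarith [hy, hL0]

/-- **PROOF of node (ii) of #181.1** (`HighTemperatureNoThermalStiffnessTT'`, bounds.tex Thm 12 (ii)).
[this file, via #181.1's reduction] -/
theorem highTemperatureNoThermalStiffnessTT'_holds : HighTemperatureNoThermalStiffnessTT' :=
  highTemperatureNoThermalStiffnessTT'_of_insensitivity highTemperatureTwistInsensitivityTT'_holds

/-- **PROOF of the certified node of #181.1** (`HighTemperatureNoThermalStiffnessTT'At160`): no thermal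
phase stiffness for `T ≥ 160(|t|+|t'|)`, `ρ_s ≤ 0.754 L² e^{-L/1000}/(β θ₀²)`, uniformly in `U, μ`.
[this file, via #181.1's reduction and its kernel-certified `kpBarLHS_inst160`] -/
theorem highTemperatureNoThermalStiffnessTT'At160_holds : HighTemperatureNoThermalStiffnessTT'At160 :=
  highTemperatureNoThermalStiffnessTT'At160_of_insensitivity highTemperatureTwistInsensitivityTT'_holds

/-- **Node (certified reading `T ≥ 160(|t|+|t'|)` of Thm 12 (i); PROVED below).** For `L ≥ 3`, real
`t', U, μ`, `β > 0` with `β(1+|t'|) ≤ 1/160`, and every seam twist `θ`: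
`|log Re Z(0) - log Re Z(θ)| ≤ 0.754 L² e^{-L/1000}`. Sharpens #196's `…At400` (window `400`,
bound `(3/4) L² e^{-L/1000}`) to the paper's window via the Hölder constant and #181.1's
kernel-certified `kpBarLHS_inst160`. [programme node: bounds.tex §12 Thm 12 (i), Remark 12(d)] -/
@[conjecture] def HighTemperatureTwistInsensitivityTT'At160 : Prop :=
  ∀ (L : ℕ) [NeZero L], 3 ≤ L → ∀ (t' U μ β : ℝ), 0 < β → β * (1 + |t'|) ≤ 1 / 160 →
    ∀ θ : ℝ,
      |Real.log (partitionFn β (hubbardTorusTT'FluxMu L t' U μ 0)).re -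
          Real.log (partitionFn β (hubbardTorusTT'FluxMu L t' U μ θ)).re| ≤
        2 * (377 / 1000) * (L : ℝ) ^ 2 * Real.exp (-(1 / 1000 * L))

/-- PROOF of the node `HighTemperatureTwistInsensitivityTT'At160` (node (i) at `a = 0.377`,
`b = 10⁻³`, monotonicity of `KP̄` in `y` and `kpBarLHS_inst160`). [this file] -/
theorem highTemperatureTwistInsensitivityTT'At160_holds : HighTemperatureTwistInsensitivityTT'At160 := by
  intro L _ hL t' U μ β hβ hT θ
  have hy : 0 ≤ β * (1 + |t'|) := by positivity
  have hkp : kpBarLHS (β * (1 + |t'|)) (377 / 1000) (1 / 1000) ≤ 377 / 1000 :=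
    (kpBarLHS_mono hy hT (by norm_num)).trans kpBarLHS_inst160
  exact highTemperatureTwistInsensitivityTT'_holds L hL t' U μ β (377 / 1000) (1 / 1000) hβ
    (by norm_num) (by norm_num) hkp θ

end Torus

end Summit.HubbardSuperconductivity.HubbardLadder.Bounds
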